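import Literature.Barriers.CriticalPhenomena.WeaklySAWPerturbativeBetaLimit
import Literature.Probability.LatticeModels.LatticeGreenAsymptotics
import Literature.MathematicalPhysics.QuantumFieldTheory.Balaban1983to89.Beta.ShellValue
import Literature.Geometry.GaugeTheory.BPSTInformationMetric
import HarnessLib

/-!
# BBS-III, Lemma 6.3(a): the VALUE of the limit of the perturbative coefficients of the 4-dimensional weakly
# self-avoiding walk — `lim_{j→∞} β_j(m² = 0) = (log L)/π²` — and the `L`-uniform two-sided form
# `|β_j(0) − (log L)/π²| ≤ A` for ALL `j ≥ 0` and ALL `L ≥ 2`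

Sequel of `WeaklySAWPerturbativeBetaLimit.lean`, which proves for the explicit finite-range decomposition
`C_i = LongRangePhi4.FRD.Gam 4 L m² i` of the tree ([Baue13a] / Bauerschmidt–Brydges–Slade, LNM 2242, Ch. 3) that
`β_j(0) = CTWSAW.betaPT 4 L 0 j → CTWSAW.betaLim L > 0` with the rate `K(j+1)L^{−j}`, and records verbatim in its header:
«Since `Σ_{j<N}β_j = 8Σ_xw_N(x)²` grows like `N log L/π²` — the logarithmic divergence of the bubble in `d = 4` — the
limit is the universal `log L/π²` of [BBS-rg-pt]; only its existence and positivity, which is what (A1) requires, are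
established here.»  THIS FILE PROVES THE VALUE.

Source.  R. Bauerschmidt, D. C. Brydges, G. Slade, *A renormalisation group method. III. Perturbative analysis*,
J. Stat. Phys. **159** (2015) 492–529, arXiv:1403.7252 [BauerschmidtBrydgesSlade2015RGIII], §6.3, **Lemma 6.3 (a)**
(numbered 6.1.3 in some printings), verbatim (arXiv TeX, `lem:betalim`): «(a) For `m² = 0`, `lim_{j→∞} β_j = 0` for
`d > 4`, whereas `lim_{j→∞} β_j = (log L)/π²` for `d = 4`.»  Printed proof: with the scaling function `c₀` of
Proposition 6.1 (c) (`C_{j;x,y} = c_j(x−y) + O(L^{−(d−1)(j−1)})`, `c_j(x) = L^{−2j}c₀(L^{−j}x)`), Riemann sums give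
`β_j = β_∞ + O(L^{−j})` with `β_∞ = 8Σ_{k∈ℤ}⟨c₀,c_k⟩ = 8⟨c₀,v⟩`, `v = Σ_k c_k`, `v̂(ξ) = |ξ|⁻²`, and «by Fubini's
theorem, radial symmetry, and `∫₀^∞ρ dt = 1`, `⟨c₀,v⟩ = (ω₃/(2π)⁴)∫₀^∞(∫_t^{Lt} dr/r)ρ(t)dt` … The inner integral in
the last equation is equal to `log L`. Thus … `β_∞ = (8ω₃/(2π)⁴) log L = (log L)/π²`», `ω₃ = 2π²`.  Also used, from
R. Bauerschmidt, D. C. Brydges, G. Slade, *Logarithmic correction for the susceptibility of the 4-dimensional weakly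
self-avoiding walk: a renormalisation group analysis*, Commun. Math. Phys. **337** (2015) 817–877
[BauerschmidtBrydgesSlade2015LogCorr]: §6.1 (definition of `β_j`, `w_j`; Assumption (A1)), §5.1–5.2 (finite range and
scaling estimates of `C_j`), Lemma 8.3.1 (proof, first display: `Σ_{j<k}β_j = 8Σ_xw_k(x)²`).

THE ROUTE TAKEN HERE (a different, elementary proof of the printed value; the printed `c₀`-route is the tree's
`FiniteRangeDecompositionSelfSimilarity` / `…PairAsymptotics` / `WeaklySAWPerturbativeBetaLimit`, which gives EXISTENCE
of the limit).  By the telescoped form `Σ_{j<k}β_j(0) = 8Σ_x w_k(x)²` (tree: `CTWSAW.sum_range_betaPT`) it suffices to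
show `8Σ_x w_k(x)² = k·(log L)/π² + O(1)` UNIFORMLY in `k ≥ 1` and `L ≥ 2`; then Cesàro against the existing limit gives
`betaLim L = (log L)/π²`, and differencing consecutive `k` gives the two-sided bound for EVERY `j`.  For the estimate:
(i) `w_k = (−Δ_{ℤ⁴})⁻¹ − Σ_{i>k}C_i` pointwise (massless decomposition, tree: `FRD.hasSum_Gam_massless'`,
`(−Δ)⁻¹_{0x} = ½·latticeGreen x`) with the tail `|Σ_{i>k}C_i| ≤ (4c/3)L^{−2k}` uniformly in `x` (scaling estimate,
tree: `CTWSAW.abs_Gam_four_le`), and `w_k` vanishes outside `|x|₁ < ½L^k` (finite range, tree: `CTWSAW.covSum_eq_zero`);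
(ii) `(−Δ_{ℤ⁴})⁻¹(x) = 1/(4π²|x|₂²) + O(|x|₂⁻⁴)` (G. F. Lawler, V. Limic, *Random Walk: A Modern Introduction*, CUP
2010, Thm. 4.3.1 — tree: `LatticeModels.latticeGreen_asymptotics`, a kernel theorem), whence
`(−Δ)⁻¹(x)² = |x|₂⁻⁴/(16π⁴) + O(|x|₂⁻⁶)`;
(iii) the WINDOW LOGARITHM of the Euclidean quartic kernel: `Σ_{0<‖x‖_∞≤M}|x|₂⁻⁴ = 2π²·log M + O(1)` — from the
β-sub-cell kernels of the audit cell `pub-balaban` (T. Bałaban's lattice Yang–Mills series): dyadic Riemann sums with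
rate for the class of degree-`(−4)` homogeneous Lipschitz kernels (`Beta.ShellRiemann.windowLog_integral`), the polar
reduction `∫_{1<‖x‖_∞≤2}F = log 2·∫_{S³}F dσ` (`Beta.ShellValue.integral_shell_eq_log_mul_angAvg`), and `σ(S³) = 2π²`
(Mathlib: `Measure.toSphere_real_apply_univ`, `EuclideanSpace.volume_ball`);
(iv) power counting of the error terms over sup-norm shells (`#{‖x‖_∞ = r} ≤ 80r³` in `ℤ⁴`,
`Beta.TransferUV.abs_sum_annulus_zero_le`, `Beta.TransferUV.sum_inv_pow_le_two`): `Σ|x|⁻⁶` converges, the cross term `2(−Δ)⁻¹·tail` costs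
`L^{−2k}·Σ_{|x|≲L^k}|x|⁻² = O(1)`, the squared tail costs `L^{−4k}·#{|x| ≲ L^k} = O(1)`.
Every constant is independent of `L ≥ 2` and of `k`; only the constants `c` (scaling estimate) and `K` (Green
asymptotics), which the tree provides existentially, are not numerically explicit, so the final `A` is existential.

HONEST FRAMING (for the audit cell `pub-balaban`, β sub-cell, row BETA-lit2 «marginal-flow technology», unit
`b2b-balaban-beta-lit2` gen 5, companion prose `run/shared/lean/pub/pub-balaban/BETA/TRANSFER.md` v5 §12): this is a
theorem about the Bauerschmidt–Brydges–Slade finite-range scheme for the 4d weakly self-avoiding walk / `|φ|⁴` model, a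
SIBLING model.  It says NOTHING about Bałaban's β-functions ([Balaban1987RG1] (1.22)); no transfer statement is
claimed or exists.  What it exhibits, kernel-checked end-to-end from the definitions, is the MECHANISM the β sub-cell's
wall is typed in (BETA-SPEC §8.6: `Beta.LargeL.LogGrowth` — «universal logarithm `b·log L` + remainder bounded
uniformly in the scale AND in `L`», leading kernel identified with a continuum sphere moment, remainder one power
better, unit-share bounded): here `b = 1/π² = 8·(1/16π⁴)·2π²·`(per unit `log L`), and the (AF-0-L) conclusion «`β_j > 0`
for ALL `j` once `L ≥ L₁`» follows by the cell's own bookkeeping (`Beta.LargeL.uniform_lower_of_exp_le`) — a form the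
source does not state (it fixes `L` and obtains positivity for `j ≥ n₀`, Lemma 6.3.1/Prop. 4.2.2).  Discharging
`BetaPertH` (which this file does not touch) would make Bałaban's UV stability UNCONDITIONAL — a real constructive-QFT
result; it is NOT the continuum limit and NOT the Clay problem.

## What this file proves (everything; auxiliary definitions `euclidQuartic`, `windowConst`, `green`, `covTail`,
`boxRadius`; NO `def … : Prop`, no named fact, no hypothesis on any theorem beyond `2 ≤ L`)

* §1 `euclidQuartic x = |x|₂⁻⁴`, `homogKernel_euclidQuartic : HomogKernel euclidQuartic 1 131072`;
* §2 `angAvg_one : ∫_{S³}dσ = 2π²` (from Mathlib's `toSphere` and the tree's `BPST.volume_real_ball_four`),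
  `angAvg_euclidQuartic`,
  `integral_shell_euclidQuartic : ∫_{1<‖x‖_∞≤2}|x|₂⁻⁴dx = 2π²·log 2`, `abs_windowSum_euclidQuartic_sub_le :
  |Σ_{0<‖w‖_∞≤M}|w|₂⁻⁴ − 2π²·log M| ≤ windowConst` (`M ≥ 1`; `windowConst = 1312·131073 + 2π²log 2`);
* §3 the `d = 4` Green function `green = ½·latticeGreen`: `abs_green_sub_le` (`|G(x) − 1/(4π²|x|₂²)| ≤ K/|x|₂⁴`),
  `abs_green_le` (`|G(x)| ≤ K₁/|x|₂²`), `abs_green_sq_sub_le` (`|G(x)² − |x|₂⁻⁴/(16π⁴)| ≤ K₃/|x|₂⁶`);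
* §4 the tail `covTail L k x = Σ_{i>k}C_i(x)`: `covSum_add_covTail` (`w_k + T_k = G`), `abs_covTail_le`
  (`|T_k| ≤ (4c/3)/L^{2k}`);
* §5 `boxRadius`, `tsum_covSum_sq_eq_sum_box`, `sum_box_eq_add_sum_annulus`, the elementary sums
  `sum_range_succ_le_sq` / `sum_range_succ_cube_le` (and `TransferUV.sum_inv_pow_le_two`), the pointwise
  error `abs_sq_sub_leading_le`, and **`abs_eight_tsum_covSum_sq_sub_le`**: `∃ A, ∀ L ≥ 2, ∀ k ≥ 1,
  |8Σ_xw_k(x)² − k·log L/π²| ≤ A`; hence **`abs_sum_range_betaPT_zero_sub_le`**: `|Σ_{j<k}β_j(0) − k·log L/π²| ≤ A`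
  for all `k` (Lemma 8.3.1's telescoping);
* §6 **`abs_betaPT_zero_sub_log_le`** — `∃ A, ∀ L ≥ 2, ∀ j, |β_j(0) − (log L)/π²| ≤ A`;
  `tendsto_cesaro_betaPT_zero`; **`betaLim_eq_log`** — `CTWSAW.betaLim L = (log L)/π²` (`L ≥ 2`);
  **`BBS2015RGIII_lem63a`** — `β_j(0) → (log L)/π²` (the printed statement, `d = 4`); `innerG0_series_eq_log`
  (`8(2Σ_{l≥0}L^{−2l}J_l − J_0) = (log L)/π²`); `logGrowth_betaPT_zero` / `logGrowthLower_betaPT_zero` — the cell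
  shape `Beta.LargeL.LogGrowth (fun L k => β_k(0)) (1/π²) A` at natural `L`; `le_betaPT_zero_of_exp_le` — for natural
  `L ≥ 2` with `exp(π²(A + 2b₀)) ≤ L`, `β_k(0) ≥ 2b₀` for EVERY `k` (via `Beta.LargeL.uniform_lower_of_exp_le`);
  `le_betaPT_zero_of_le_log` — the same for real `L`: `π²(A + m) ≤ log L ⟹ β_j(0) ≥ m` for all `j`.
-/

noncomputable section

open MeasureTheory Filter Topology Finset Real
open Literature.Probability.LatticeModels
open scoped BigOperators

namespace Literature.Barriers.CriticalPhenomena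

namespace CTWSAW

open LongRangePhi4 LongRangePhi4.FRD
open Literature.MathematicalPhysics.QuantumFieldTheory.Balaban1983to89.Beta.DyadicShell (Pt supNorm HomogKernel toReal
  toReal_apply norm_toReal supNorm_pos toReal_eq_zero_iff supNorm_eq_of_mem_sphere ne_zero_of_mem_annulus)
open Literature.MathematicalPhysics.QuantumFieldTheory.Balaban1983to89.Beta.LeadingCoefficient (normSq normSq_nonneg
  norm_sq_le_normSq normSq_smul normSq_pos quarter_le_normSq normSq_le_sixteen abs_normSq_sub_le)
open Literature.MathematicalPhysics.QuantumFieldTheory.Balaban1983to89.Beta.ShellRiemann (shell windowLog_integral)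
open Literature.MathematicalPhysics.QuantumFieldTheory.Balaban1983to89.Beta.ShellValue (E4 angAvg normSq_ofLp_sphere
  integral_shell_eq_log_mul_angAvg)
open Literature.MathematicalPhysics.QuantumFieldTheory.Balaban1983to89.Beta.TransferUV (sum_annulus_zero_eq_sum_shells
  abs_sum_annulus_zero_le card_annulus_succ_four_le box_subset sum_inv_pow_le_two)

/-! ## 1. The Euclidean quartic kernel `|x|₂⁻⁴` on `ℝ⁴` as a `HomogKernel` -/

/-- `E(x) = |x|₂⁻⁴ = 1/(Σ_i x_i²)²` on `ℝ⁴` (value `0` at `0`): the leading kernel of the squared massless Green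
function, `(−Δ)⁻¹(x)² ≈ E(x)/(16π⁴)`. [folklore] -/
def euclidQuartic (x : Fin 4 → ℝ) : ℝ := 1 / normSq x ^ 2

/-- Degree `−4` homogeneity: `E(tx) = E(x)/t⁴` (`t > 0`). [folklore] -/
theorem euclidQuartic_smul {t : ℝ} (ht : 0 < t) (x : Fin 4 → ℝ) :
    euclidQuartic (t • x) = euclidQuartic x / t ^ 4 := by
  unfold euclidQuartic
  rw [normSq_smul]
  have ht0 : t ≠ 0 := ht.ne'
  by_cases hx : normSq x = 0
  · simp [hx]
  · field_simp

/-- The mean-value inequality behind the Lipschitz bound: for `a, b ∈ [1/4, 16]`, `|a⁻² − b⁻²| ≤ 8192·|a − b|`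
(`a⁻² − b⁻² = (b − a)(a + b)/(a²b²)`, `a + b ≤ 32`, `a²b² ≥ 1/256`). [folklore] -/
theorem abs_inv_sq_sub_inv_sq_le {a b : ℝ} (ha : 1 / 4 ≤ a) (ha' : a ≤ 16) (hb : 1 / 4 ≤ b) (hb' : b ≤ 16) :
    |1 / a ^ 2 - 1 / b ^ 2| ≤ 8192 * |a - b| := by
  have ha0 : 0 < a := by linarith
  have hb0 : 0 < b := by linarith
  have e : 1 / a ^ 2 - 1 / b ^ 2 = (b - a) * ((a + b) / (a ^ 2 * b ^ 2)) := by
    field_simp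
    ring
  rw [e, abs_mul, abs_sub_comm b a, mul_comm]
  refine mul_le_mul_of_nonneg_right ?_ (abs_nonneg _)
  rw [abs_of_nonneg (by positivity), div_le_iff₀ (by positivity)]
  have h1 : 1 / 16 ≤ a ^ 2 := by nlinarith
  have h2 : 1 / 16 ≤ b ^ 2 := by nlinarith
  have h3 : 1 / 256 ≤ a ^ 2 * b ^ 2 := by
    calc (1 : ℝ) / 256 = 1 / 16 * (1 / 16) := by norm_num
      _ ≤ a ^ 2 * b ^ 2 := mul_le_mul h1 h2 (by norm_num) (by positivity)
  nlinarith

/-- **`|x|₂⁻⁴` is a `HomogKernel` with `A = 1`, `Λ = 131072 = 8192·16`** (degree `−4` homogeneity; `|x|₂ ≥ ‖x‖_∞ = 1`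
on the unit sup-sphere; on the shell `1/2 ≤ ‖x‖_∞ ≤ 2` one has `|x|₂² ∈ [1/4, 16]` and `||x|₂² − |y|₂²| ≤ 16‖x − y‖`).
[folklore] -/
theorem homogKernel_euclidQuartic : HomogKernel euclidQuartic 1 131072 := by
  refine ⟨by norm_num, by norm_num, ?_, ?_, ?_⟩
  · intro t ht x _
    exact euclidQuartic_smul ht x
  · intro x hx
    have h1 : 1 ≤ normSq x := by
      have := norm_sq_le_normSq x
      rw [hx, one_pow] at this
      exact this
    unfold euclidQuartic
    rw [abs_of_nonneg (by positivity), div_le_iff₀ (by positivity)]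
    nlinarith
  · intro x y hx1 hx2 hy1 hy2
    unfold euclidQuartic
    calc |1 / normSq x ^ 2 - 1 / normSq y ^ 2| ≤ 8192 * |normSq x - normSq y| :=
          abs_inv_sq_sub_inv_sq_le (quarter_le_normSq hx1) (normSq_le_sixteen hx2) (quarter_le_normSq hy1)
            (normSq_le_sixteen hy2)
      _ ≤ 8192 * (16 * ‖x - y‖) := mul_le_mul_of_nonneg_left (abs_normSq_sub_le hx2 hy2) (by norm_num)
      _ = 131072 * ‖x - y‖ := by ring

/-! ## 2. `σ(S³) = 2π²` and the window logarithm of `|x|₂⁻⁴`: `Σ_{0<‖w‖_∞≤M}|w|₂⁻⁴ = 2π²·log M + O(1)` -/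

/-- **`∫_{S³} dσ = 2π²`** for Mathlib's sphere measure `σ = volume.toSphere` on the Euclidean unit sphere of `ℝ⁴`
(`σ(S³) = 4·vol(B⁴) = 4·π²/2`, the ball volume being the tree's `BPST.volume_real_ball_four`; the `ω₃ = 2π²` of the
printed proof). [cite: BauerschmidtBrydgesSlade2015RGIII, Lemma 6.3 (proof of (a): «ω₃ = 2π² is the surface measure of the 3-sphere»)] -/
theorem angAvg_one : angAvg (fun _ => (1 : ℝ)) = 2 * π ^ 2 := by
  rw [angAvg, integral_const, smul_eq_mul, mul_one, Measure.toSphere_real_apply_univ, finrank_euclideanSpace,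
    Fintype.card_fin, Literature.Geometry.GaugeTheory.BPST.volume_real_ball_four]
  push_cast
  ring

/-- On the unit sphere `|x|₂⁻⁴ = 1`, hence `∫_{S³}|x|₂⁻⁴dσ = 2π²`. [folklore] -/
theorem angAvg_euclidQuartic : angAvg euclidQuartic = 2 * π ^ 2 := by
  rw [← angAvg_one, angAvg, angAvg]
  refine integral_congr_ae (ae_of_all _ fun α => ?_)
  show euclidQuartic (WithLp.ofLp (α : E4)) = 1
  rw [euclidQuartic, normSq_ofLp_sphere, one_pow, div_one]

/-- **`∫_{1<‖x‖_∞≤2} |x|₂⁻⁴ dx = 2π²·log 2`** (polar reduction for the class + `σ(S³) = 2π²`). [folklore] -/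
theorem integral_shell_euclidQuartic : ∫ x in shell, euclidQuartic x = Real.log 2 * (2 * π ^ 2) := by
  rw [integral_shell_eq_log_mul_angAvg homogKernel_euclidQuartic, angAvg_euclidQuartic]

/-- The explicit window constant `W₀ = 1312·(1 + 131072) + 2π²·log 2`. [folklore] -/
def windowConst : ℝ := 1312 * (1 + 131072) + Real.log 2 * (2 * π ^ 2)

/-- **THE WINDOW LOGARITHM OF `|x|₂⁻⁴`**: `|Σ_{0<‖w‖_∞≤M} |w|₂⁻⁴ − 2π²·log M| ≤ W₀` for every `M ≥ 1` — the lattice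
version of `∫_{1≤|x|≤M}|x|⁻⁴d⁴x = ω₃·log M`. [folklore] -/
theorem abs_windowSum_euclidQuartic_sub_le {M : ℕ} (hM : 1 ≤ M) :
    |∑ w ∈ annulus 4 0 M, euclidQuartic (toReal w) - 2 * π ^ 2 * Real.log M| ≤ windowConst := by
  have hlog : Real.log 2 ≠ 0 := (Real.log_pos one_lt_two).ne'
  have h := windowLog_integral homogKernel_euclidQuartic M hM
  rw [integral_shell_euclidQuartic, mul_div_cancel_left₀ (2 * π ^ 2) hlog] at h
  rw [windowConst]
  refine h.trans (le_of_eq ?_)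
  rw [abs_of_pos (by positivity)]


/-! ## 3. The massless Green function of `ℤ⁴`: `G = ½·latticeGreen = 1/(4π²|x|₂²) + O(|x|₂⁻⁴)` -/

/-- `G(x) = (−Δ_{ℤ⁴})⁻¹_{0x} = ½·latticeGreen x` (tree normalisation `latticeGreen = G_{SRW}/d`,
`FRD.resolventZd_zero_eq_half_latticeGreen`). [folklore] -/
def green (x : Site 4) : ℝ := latticeGreen x / 2

/-- `|x|₂²` of a lattice point, coordinatewise. [folklore] -/
theorem normSq_toReal (x : Site 4) : normSq (toReal x) = ∑ i, ((x i : ℤ) : ℝ) ^ 2 := by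
  simp [normSq, toReal_apply]

/-- `‖x‖_∞² ≤ |x|₂²` on the lattice. [folklore] -/
theorem sq_supNorm_le_normSq (x : Site 4) : ((supNorm x : ℕ) : ℝ) ^ 2 ≤ normSq (toReal x) := by
  have h := norm_sq_le_normSq (toReal x)
  rwa [norm_toReal] at h

/-- `1 ≤ |x|₂²` for `x ≠ 0`. [folklore] -/
theorem one_le_normSq_toReal {x : Site 4} (hx : x ≠ 0) : 1 ≤ normSq (toReal x) := by
  have h1 : (1 : ℝ) ≤ (supNorm x : ℝ) := by exact_mod_cast supNorm_pos hx
  have h2 := sq_supNorm_le_normSq x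
  nlinarith

/-- **`|G(x) − 1/(4π²|x|₂²)| ≤ K/|x|₂⁴`** for `x ≠ 0`: the `d = 4` case of the tree's Green-function asymptotics
(`a₄ = 4Γ(1)/(2π²)`, so `(−Δ)⁻¹ = latticeGreen/2 ∼ 1/(4π²|x|²)`). [cite: LawlerLimic2010, Theorem 4.3.1] -/
theorem abs_green_sub_le : ∃ K : ℝ, 0 ≤ K ∧ ∀ x : Site 4, x ≠ 0 →
    |green x - 1 / (4 * π ^ 2 * normSq (toReal x))| ≤ K / normSq (toReal x) ^ 2 := by
  obtain ⟨K, hK⟩ := latticeGreen_asymptotics (d := 4) (by norm_num)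
  refine ⟨|K| / 2, by positivity, fun x hx => ?_⟩
  have h := hK x hx
  set S : ℝ := ∑ i, ((x i : ℤ) : ℝ) ^ 2 with hS
  have hSeq : normSq (toReal x) = S := normSq_toReal x
  have hS1 : 1 ≤ S := hSeq ▸ one_le_normSq_toReal hx
  have hS0 : 0 < S := by linarith
  have hsq : Real.sqrt S ^ 2 = S := Real.sq_sqrt hS0.le
  have hsq0 : 0 < Real.sqrt S := Real.sqrt_pos.mpr hS0
  have e1 : Real.Gamma (((4 : ℕ) : ℝ) / 2 - 1) = 1 := by norm_num
  have e2 : (π : ℝ) ^ (((4 : ℕ) : ℝ) / 2) = π ^ 2 := by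
    rw [show (((4 : ℕ) : ℝ) / 2) = ((2 : ℕ) : ℝ) by norm_num, Real.rpow_natCast]
  have e3 : Real.sqrt S ^ (2 - ((4 : ℕ) : ℝ)) = 1 / S := by
    rw [show (2 - ((4 : ℕ) : ℝ)) = -((2 : ℕ) : ℝ) by norm_num, Real.rpow_neg hsq0.le, Real.rpow_natCast, hsq,
      one_div]
  have e4 : Real.sqrt S ^ (-((4 : ℕ) : ℝ)) = 1 / S ^ 2 := by
    rw [Real.rpow_neg hsq0.le, Real.rpow_natCast, show (4 : ℕ) = 2 * 2 by norm_num, pow_mul, hsq, one_div]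
  rw [e1, e2, e3, e4] at h
  rw [hSeq, green]
  have e5 : latticeGreen x / 2 - 1 / (4 * π ^ 2 * S) = (latticeGreen x - 1 / (2 * π ^ 2) * (1 / S)) / 2 := by
    field_simp
    ring
  rw [e5, abs_div, abs_two]
  calc |latticeGreen x - 1 / (2 * π ^ 2) * (1 / S)| / 2 ≤ K * (1 / S ^ 2) / 2 := by gcongr
    _ ≤ |K| * (1 / S ^ 2) / 2 := by gcongr; exact le_abs_self K
    _ = |K| / 2 / S ^ 2 := by ring

/-- `|G(x)| ≤ K₁/|x|₂²` for `x ≠ 0` (`K₁ = 1/(4π²) + K`). [folklore] -/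
theorem abs_green_le : ∃ K₁ : ℝ, 0 ≤ K₁ ∧ ∀ x : Site 4, x ≠ 0 → |green x| ≤ K₁ / normSq (toReal x) := by
  obtain ⟨K, hK, h⟩ := abs_green_sub_le
  refine ⟨1 / (4 * π ^ 2) + K, by positivity, fun x hx => ?_⟩
  set S := normSq (toReal x) with hS
  have hS1 : 1 ≤ S := one_le_normSq_toReal hx
  have hS0 : 0 < S := by linarith
  have h1 := h x hx
  have h2 : K / S ^ 2 ≤ K / S := by
    rw [div_le_div_iff₀ (by positivity) hS0]
    calc K * S ≤ K * S * S := le_mul_of_one_le_right (by positivity) hS1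
      _ = K * S ^ 2 := by ring
  have h3 : |green x| ≤ |green x - 1 / (4 * π ^ 2 * S)| + |1 / (4 * π ^ 2 * S)| := by
    have := abs_add_le (green x - 1 / (4 * π ^ 2 * S)) (1 / (4 * π ^ 2 * S))
    rwa [sub_add_cancel] at this
  rw [abs_of_pos (by positivity : (0 : ℝ) < 1 / (4 * π ^ 2 * S))] at h3
  calc |green x| ≤ K / S ^ 2 + 1 / (4 * π ^ 2 * S) := by linarith
    _ ≤ K / S + 1 / (4 * π ^ 2 * S) := by linarith
    _ = (1 / (4 * π ^ 2) + K) / S := by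
        field_simp
        ring

/-- **`|G(x)² − |x|₂⁻⁴/(16π⁴)| ≤ K₃/|x|₂⁶`** for `x ≠ 0` (`G² − a² = (G − a)(G + a)`, `a = 1/(4π²|x|₂²)`).
[folklore] -/
theorem abs_green_sq_sub_le : ∃ K₃ : ℝ, 0 ≤ K₃ ∧ ∀ x : Site 4, x ≠ 0 →
    |green x ^ 2 - euclidQuartic (toReal x) / (16 * π ^ 4)| ≤ K₃ / normSq (toReal x) ^ 3 := by
  obtain ⟨K, hK, h⟩ := abs_green_sub_le
  refine ⟨K * (K + 1 / (2 * π ^ 2)), by positivity, fun x hx => ?_⟩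
  set S := normSq (toReal x) with hS
  have hS1 : 1 ≤ S := one_le_normSq_toReal hx
  have hS0 : 0 < S := by linarith
  set a : ℝ := 1 / (4 * π ^ 2 * S) with ha
  have ha0 : 0 ≤ a := by positivity
  have hga : |green x - a| ≤ K / S ^ 2 := h x hx
  have hsum : |green x + a| ≤ (K + 1 / (2 * π ^ 2)) / S := by
    have e : green x + a = (green x - a) + 2 * a := by ring
    rw [e]
    calc |green x - a + 2 * a| ≤ |green x - a| + |2 * a| := abs_add_le _ _
      _ ≤ K / S ^ 2 + 2 * a := by rw [abs_of_nonneg (by linarith : (0 : ℝ) ≤ 2 * a)]; linarith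
      _ ≤ K / S + 2 * a := by
          have : K / S ^ 2 ≤ K / S := by
            rw [div_le_div_iff₀ (by positivity) hS0]
            calc K * S ≤ K * S * S := le_mul_of_one_le_right (by positivity) hS1
              _ = K * S ^ 2 := by ring
          linarith
      _ = (K + 1 / (2 * π ^ 2)) / S := by rw [ha]; field_simp; ring
  have ea : euclidQuartic (toReal x) / (16 * π ^ 4) = a ^ 2 := by
    rw [euclidQuartic, ← hS, ha]
    field_simp
    norm_num
  rw [ea, sq_sub_sq, abs_mul]
  calc |green x + a| * |green x - a| ≤ (K + 1 / (2 * π ^ 2)) / S * (K / S ^ 2) :=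
        mul_le_mul hsum hga (abs_nonneg _) (by positivity)
    _ = K * (K + 1 / (2 * π ^ 2)) / S ^ 3 := by
        field_simp

/-! ## 4. The tail `Σ_{i>k} C_i` of the massless decomposition: `w_k = G − tail`, `|tail| ≤ (4c/3)L^{−2k}` -/

/-- The tail of the massless decomposition beyond scale `k`: `T_k(x) = Σ_{m≥0} C_{m+k+1;0,x}(0) = Σ_{i>k}C_i(x)`.
[folklore] -/
def covTail (L : ℝ) (k : ℕ) (x : Site 4) : ℝ := ∑' m : ℕ, Gam 4 L 0 (m + k + 1) x

/-- **`w_k + T_k = (−Δ)⁻¹`** pointwise on `ℤ⁴` (`L ≥ 2`): the massless decomposition `Σ_{i≥1}C_i(0) = (−Δ_{ℤ⁴})⁻¹`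
split at scale `k`. [cite: BauerschmidtBrydgesSlade2015LogCorr, §5.1 (display C = [−Δ_{ℤ^d}+m²]⁻¹ = Σ_{j=1}^∞ C_j, at m² = 0 for d > 2)] -/
theorem covSum_add_covTail {L : ℝ} (hL : 2 ≤ L) (k : ℕ) (x : Site 4) :
    covSum 4 L 0 k x + covTail L k x = green x := by
  have h := hasSum_Gam_massless' (d := 4) (by norm_num) hL x
  rw [green, ← h.tsum_eq, covSum, covTail]
  have h2 := h.summable.sum_add_tsum_nat_add k
  simpa [add_assoc] using h2

/-- **The tail is uniformly small: `|T_k(x)| ≤ (4c/3)/L^{2k}`** for all `x`, `k`, `L ≥ 2` (geometric series of the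
scaling estimate `|C_{i+1}| ≤ c/L^{2i}`, ratio `L⁻² ≤ 1/4`). [cite: BauerschmidtBrydgesSlade2015LogCorr, §5.2 (scaling estimate |C_{j;x,y}| ≤ cL^{−2(j−1)} at d = 4)] -/
theorem abs_covTail_le : ∃ c : ℝ, 0 < c ∧ ∀ L : ℝ, 2 ≤ L → ∀ k : ℕ, ∀ x : Site 4,
    |covTail L k x| ≤ 4 * c / 3 / L ^ (2 * k) := by
  obtain ⟨c, hc, h⟩ := abs_Gam_four_le
  refine ⟨c, hc, fun L hL k x => ?_⟩
  have hL0 : 0 < L := by linarith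
  have hL2 : (4 : ℝ) ≤ L ^ 2 := by nlinarith
  set r : ℝ := 1 / L ^ 2 with hr
  have hr0 : 0 ≤ r := by positivity
  have hr4 : r ≤ 1 / 4 := by
    rw [hr, div_le_div_iff₀ (by positivity) (by norm_num : (0:ℝ) < 4)]
    linarith
  have hr1 : r < 1 := by linarith
  have hgeo : HasSum (fun m : ℕ => c / L ^ (2 * k) * r ^ m) (c / L ^ (2 * k) * (1 - r)⁻¹) :=
    (hasSum_geometric_of_lt_one hr0 hr1).mul_left _
  have hbound : ∀ m : ℕ, ‖Gam 4 L 0 (m + k + 1) x‖ ≤ c / L ^ (2 * k) * r ^ m := by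
    intro m
    rw [Real.norm_eq_abs]
    have := h L hL 0 le_rfl (m + k) x
    refine this.trans (le_of_eq ?_)
    rw [hr, one_div, inv_pow, ← pow_mul, mul_add, pow_add]
    field_simp
  have ht := tsum_of_norm_bounded hgeo hbound
  rw [Real.norm_eq_abs] at ht
  refine ht.trans ?_
  have hinv : (1 - r)⁻¹ ≤ 4 / 3 := by
    rw [inv_le_comm₀ (by linarith) (by norm_num)]
    linarith
  calc c / L ^ (2 * k) * (1 - r)⁻¹ ≤ c / L ^ (2 * k) * (4 / 3) :=
        mul_le_mul_of_nonneg_left hinv (by positivity)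
    _ = 4 * c / 3 / L ^ (2 * k) := by ring

/-! ## 5. The estimate `8Σ_x w_k(x)² = k·(log L)/π² + O(1)`, uniformly in `k ≥ 1` and `L ≥ 2` -/

/-- The sup-norm radius `M_k = ⌊L^k/2⌋₊ + 1` of a lattice box containing the support `{|x|₁ < ½L^k}` of `w_k`.
[folklore] -/
def boxRadius (L : ℝ) (k : ℕ) : ℕ := ⌊L ^ k / 2⌋₊ + 1

/-- `M_k ≥ 1`. [folklore] -/
theorem one_le_boxRadius (L : ℝ) (k : ℕ) : 1 ≤ boxRadius L k := Nat.le_add_left 1 _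

/-- `½L^k < M_k`. [folklore] -/
theorem lt_boxRadius (L : ℝ) (k : ℕ) : L ^ k / 2 < boxRadius L k := by
  rw [boxRadius]
  push_cast
  exact Nat.lt_floor_add_one _

/-- `M_k ≤ ½L^k + 1 ≤ L^k` (`L ≥ 2`, `k ≥ 1`). [folklore] -/
theorem boxRadius_le {L : ℝ} (hL : 2 ≤ L) {k : ℕ} (hk : 1 ≤ k) : (boxRadius L k : ℝ) ≤ L ^ k := by
  have hLk : (2 : ℝ) ≤ L ^ k := by
    calc (2 : ℝ) = 2 ^ 1 := by norm_num
      _ ≤ L ^ 1 := by rw [pow_one, pow_one]; exact hL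
      _ ≤ L ^ k := pow_le_pow_right₀ (by linarith) hk
  rw [boxRadius]
  push_cast
  have := Nat.floor_le (show (0 : ℝ) ≤ L ^ k / 2 by positivity)
  linarith

/-- `k·log L − log 2 ≤ log M_k ≤ k·log L`. [folklore] -/
theorem abs_log_boxRadius_sub_le {L : ℝ} (hL : 2 ≤ L) {k : ℕ} (hk : 1 ≤ k) :
    |Real.log (boxRadius L k) - k * Real.log L| ≤ Real.log 2 := by
  have hL0 : 0 < L := by linarith
  have hLk : 0 < L ^ k := pow_pos hL0 k
  have hM0 : (0 : ℝ) < boxRadius L k := by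
    have := one_le_boxRadius L k
    exact_mod_cast Nat.lt_of_lt_of_le Nat.zero_lt_one this
  have hup : Real.log (boxRadius L k) ≤ k * Real.log L := by
    rw [← Real.log_pow]
    exact Real.log_le_log hM0 (boxRadius_le hL hk)
  have hlow : k * Real.log L - Real.log 2 ≤ Real.log (boxRadius L k) := by
    rw [← Real.log_pow, ← Real.log_div hLk.ne' two_ne_zero]
    exact Real.log_le_log (by positivity) (lt_boxRadius L k).le
  rw [abs_le]
  constructor <;> linarith [Real.log_pos one_lt_two]

/-- `Σ_x w_k(x)²` as a finite sum over the sup-norm box of radius `M ≥ ½L^k` (finite range of `w_k`).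
[cite: BauerschmidtBrydgesSlade2015LogCorr, §5.1 (finite range C_{j;x,y} = 0 if |x−y| ≥ ½L^j)] -/
theorem tsum_covSum_sq_eq_sum_box {L : ℝ} (hL : 2 ≤ L) (k : ℕ) {M : ℕ} (hM : L ^ k / 2 ≤ M) :
    ∑' x : Site 4, covSum 4 L 0 k x ^ 2 = ∑ x ∈ box 4 M, covSum 4 L 0 k x ^ 2 := by
  refine tsum_eq_sum fun x hx => ?_
  have hx' : ∃ i, (M : ℤ) < |x i| := by
    by_contra hcon
    push Not at hcon
    exact hx (mem_box.mpr fun i => abs_le.mp (hcon i))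
  obtain ⟨i, hi⟩ := hx'
  have h1 : (M : ℝ) + 1 ≤ ((∑ j, (x j).natAbs : ℕ) : ℝ) := by
    have h2 : (M : ℤ) + 1 ≤ ((x i).natAbs : ℤ) := by
      rw [Int.natCast_natAbs]; exact Int.lt_iff_add_one_le.mp hi
    have h3 : (x i).natAbs ≤ ∑ j, (x j).natAbs :=
      Finset.single_le_sum (f := fun j => (x j).natAbs) (fun j _ => Nat.zero_le _) (Finset.mem_univ i)
    have h4 : (M : ℤ) + 1 ≤ ((∑ j, (x j).natAbs : ℕ) : ℤ) := h2.trans (by exact_mod_cast h3)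
    exact_mod_cast h4
  rw [covSum_eq_zero (by norm_num) (by linarith) le_rfl (by linarith)]
  ring

/-- `box 4 0 = {0}`. [folklore] -/
theorem box_four_zero : box 4 0 = {0} := by
  ext x
  simp only [mem_box, Finset.mem_singleton, Nat.cast_zero, neg_zero]
  constructor
  · intro h
    funext i
    have := h i
    show x i = 0
    omega
  · rintro rfl i
    simp

/-- A box sum is the value at the origin plus the sum over the punctured box `annulus 4 0 M`. [folklore] -/
theorem sum_box_eq_add_sum_annulus (f : Site 4 → ℝ) (M : ℕ) :
    ∑ x ∈ box 4 M, f x = f 0 + ∑ x ∈ annulus 4 0 M, f x := by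
  rw [annulus, ← Finset.sum_sdiff (box_subset 4 (Nat.zero_le M)), box_four_zero, Finset.sum_singleton, add_comm]

/-- `Σ_{r<M} (r+1) ≤ M²`. [folklore] -/
theorem sum_range_succ_le_sq (M : ℕ) : ∑ r ∈ Finset.range M, ((r : ℝ) + 1) ≤ (M : ℝ) ^ 2 := by
  calc ∑ r ∈ Finset.range M, ((r : ℝ) + 1) ≤ ∑ _r ∈ Finset.range M, (M : ℝ) := by
        refine Finset.sum_le_sum fun r hr => ?_
        have := Finset.mem_range.mp hr
        exact_mod_cast this
    _ = (M : ℝ) ^ 2 := by rw [Finset.sum_const, Finset.card_range, nsmul_eq_mul]; ring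

/-- `Σ_{r<M} (r+1)³ ≤ M⁴`. [folklore] -/
theorem sum_range_succ_cube_le (M : ℕ) : ∑ r ∈ Finset.range M, ((r : ℝ) + 1) ^ 3 ≤ (M : ℝ) ^ 4 := by
  calc ∑ r ∈ Finset.range M, ((r : ℝ) + 1) ^ 3 ≤ ∑ _r ∈ Finset.range M, (M : ℝ) ^ 3 := by
        refine Finset.sum_le_sum fun r hr => ?_
        have h1 : (r : ℝ) + 1 ≤ M := by exact_mod_cast Finset.mem_range.mp hr
        exact pow_le_pow_left₀ (by positivity) h1 3
    _ = (M : ℝ) ^ 4 := by rw [Finset.sum_const, Finset.card_range, nsmul_eq_mul]; ring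

/-- **THE POINTWISE ERROR**: on the sup-norm shell of radius `r+1`, with `w = G − T`, `|T| ≤ τ`, `|G| ≤ K₁/|x|₂²`,
`|G² − |x|₂⁻⁴/(16π⁴)| ≤ K₃/|x|₂⁶` and `|x|₂ ≥ ‖x‖_∞ = r+1`:
`|w² − |x|₂⁻⁴/(16π⁴)| ≤ K₃/(r+1)⁶ + 2K₁τ/(r+1)² + τ²` (here `|G| ≤ K₁/|x|₂²` suffices). [folklore] -/
theorem abs_sq_sub_leading_le {g T a2 τ K₁ K₃ S ρ : ℝ} (hS : ρ ^ 2 ≤ S) (hρ : 1 ≤ ρ)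
    (hg : |g| ≤ K₁ / S) (hT : |T| ≤ τ) (hK₁ : 0 ≤ K₁) (hK₃ : 0 ≤ K₃)
    (hga : |g ^ 2 - a2| ≤ K₃ / S ^ 3) :
    |(g - T) ^ 2 - a2| ≤ K₃ / ρ ^ 6 + 2 * K₁ * τ / ρ ^ 2 + τ ^ 2 := by
  have hρ0 : 0 < ρ := by linarith
  have hS0 : 0 < S := lt_of_lt_of_le (by positivity) hS
  have hτ : 0 ≤ τ := (abs_nonneg T).trans hT
  have e : (g - T) ^ 2 - a2 = (g ^ 2 - a2) + (-(2 * g * T) + T ^ 2) := by ring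
  have h1 : |-(2 * g * T) + T ^ 2| ≤ 2 * |g| * τ + τ ^ 2 := by
    calc |-(2 * g * T) + T ^ 2| ≤ |-(2 * g * T)| + |T ^ 2| := abs_add_le _ _
      _ = 2 * |g| * |T| + |T| ^ 2 := by rw [abs_neg, abs_mul, abs_mul, abs_two, abs_pow]
      _ ≤ 2 * |g| * τ + τ ^ 2 := by
          have := mul_le_mul_of_nonneg_left hT (by positivity : 0 ≤ 2 * |g|)
          have h2 : |T| ^ 2 ≤ τ ^ 2 := pow_le_pow_left₀ (abs_nonneg T) hT 2
          linarith
  have h2 : K₃ / S ^ 3 ≤ K₃ / ρ ^ 6 := by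
    have : ρ ^ 6 ≤ S ^ 3 := by
      calc ρ ^ 6 = (ρ ^ 2) ^ 3 := by ring
        _ ≤ S ^ 3 := pow_le_pow_left₀ (by positivity) hS 3
    exact div_le_div_of_nonneg_left hK₃ (by positivity) this
  have h3 : 2 * |g| * τ ≤ 2 * K₁ * τ / ρ ^ 2 := by
    have hgS : |g| ≤ K₁ / ρ ^ 2 := hg.trans (div_le_div_of_nonneg_left hK₁ (by positivity) hS)
    calc 2 * |g| * τ ≤ 2 * (K₁ / ρ ^ 2) * τ := by
          exact mul_le_mul_of_nonneg_right (mul_le_mul_of_nonneg_left hgS zero_le_two) hτ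
      _ = 2 * K₁ * τ / ρ ^ 2 := by ring
  rw [e]
  calc |g ^ 2 - a2 + (-(2 * g * T) + T ^ 2)| ≤ |g ^ 2 - a2| + |-(2 * g * T) + T ^ 2| := abs_add_le _ _
    _ ≤ K₃ / S ^ 3 + (2 * |g| * τ + τ ^ 2) := add_le_add hga h1
    _ ≤ K₃ / ρ ^ 6 + 2 * K₁ * τ / ρ ^ 2 + τ ^ 2 := by linarith

/-- **THE MAIN ESTIMATE**: `∃ A, ∀ L ≥ 2, ∀ k ≥ 1, |8Σ_{x∈ℤ⁴} w_k(x)² − k·(log L)/π²| ≤ A` — the bubble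
`Σ_xw_k(x)²` grows by exactly `(log L)/(8π²)` per scale, up to an error bounded uniformly in the scale AND in `L`.
[cite: BauerschmidtBrydgesSlade2015RGIII, Lemma 6.3 (a) (d = 4: lim β_j = (log L)/π²)] -/
theorem abs_eight_tsum_covSum_sq_sub_le : ∃ A : ℝ, 0 ≤ A ∧ ∀ L : ℝ, 2 ≤ L → ∀ k : ℕ, 1 ≤ k →
    |8 * ∑' x : Site 4, covSum 4 L 0 k x ^ 2 - k * Real.log L / π ^ 2| ≤ A := by
  obtain ⟨c, hc, hT⟩ := abs_covTail_le
  obtain ⟨K₁, hK₁, hG1⟩ := abs_green_le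
  obtain ⟨K₃, hK₃, hG2⟩ := abs_green_sq_sub_le
  set τ₀ : ℝ := 4 * c / 3 with hτ₀
  have hτ₀0 : 0 ≤ τ₀ := by positivity
  set Aerr : ℝ := 80 * (2 * K₃ + 2 * K₁ * τ₀ + τ₀ ^ 2) with hAerr
  have hW0 : 0 ≤ windowConst := by rw [windowConst]; positivity
  set A : ℝ := 8 * (|green 0| + τ₀) ^ 2 + 8 * Aerr + windowConst / (2 * π ^ 4) + Real.log 2 / π ^ 2 with hA
  refine ⟨A, by positivity, fun L hL k hk => ?_⟩
  have hL0 : 0 < L := by linarith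
  -- the box radius and the tail size
  set M : ℕ := boxRadius L k with hM
  have hM1 : 1 ≤ M := one_le_boxRadius L k
  have hMR : (0 : ℝ) < M := by exact_mod_cast hM1
  have hML : (M : ℝ) ≤ L ^ k := boxRadius_le hL hk
  set τ : ℝ := τ₀ / L ^ (2 * k) with hτ
  have hLk : 0 < L ^ (2 * k) := pow_pos hL0 _
  have hτ0 : 0 ≤ τ := by positivity
  have hM2L : (M : ℝ) ^ 2 ≤ L ^ (2 * k) := by
    rw [pow_mul']
    exact pow_le_pow_left₀ hMR.le hML 2
  have hτM : τ * (M : ℝ) ^ 2 ≤ τ₀ := by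
    rw [hτ, div_mul_eq_mul_div, div_le_iff₀ hLk]
    exact mul_le_mul_of_nonneg_left hM2L hτ₀0
  have hτM4 : τ ^ 2 * (M : ℝ) ^ 4 ≤ τ₀ ^ 2 := by
    have e : τ ^ 2 * (M : ℝ) ^ 4 = (τ * (M : ℝ) ^ 2) ^ 2 := by ring
    rw [e]
    exact pow_le_pow_left₀ (by positivity) hτM 2
  have hττ₀ : τ ≤ τ₀ := by
    rw [hτ]
    refine div_le_self hτ₀0 ?_
    exact one_le_pow₀ (by linarith)
  have htail : ∀ x : Site 4, |covTail L k x| ≤ τ := fun x => hT L hL k x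
  -- w_k = G − T
  have hw : ∀ x : Site 4, covSum 4 L 0 k x = green x - covTail L k x := fun x => by
    have := covSum_add_covTail hL k x; linarith
  -- Step 1: the finite box sum, split off the origin
  have hbox : (L ^ k / 2 : ℝ) ≤ M := (lt_boxRadius L k).le
  rw [tsum_covSum_sq_eq_sum_box hL k hbox, sum_box_eq_add_sum_annulus]
  -- Step 2: the origin term
  have h0 : covSum 4 L 0 k 0 ^ 2 ≤ (|green 0| + τ₀) ^ 2 := by
    have h01 : |covSum 4 L 0 k 0| ≤ |green 0| + τ₀ := by
      rw [hw 0]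
      calc |green 0 - covTail L k 0| ≤ |green 0| + |covTail L k 0| := abs_sub _ _
        _ ≤ |green 0| + τ₀ := by linarith [htail 0]
    calc covSum 4 L 0 k 0 ^ 2 = |covSum 4 L 0 k 0| ^ 2 := (sq_abs _).symm
      _ ≤ (|green 0| + τ₀) ^ 2 := pow_le_pow_left₀ (abs_nonneg _) h01 2
  -- Step 3: the punctured box: leading term + error, shell by shell
  set err : Site 4 → ℝ := fun x => covSum 4 L 0 k x ^ 2 - euclidQuartic (toReal x) / (16 * π ^ 4) with herr
  have hsplit : ∑ x ∈ annulus 4 0 M, covSum 4 L 0 k x ^ 2 =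
      (∑ x ∈ annulus 4 0 M, euclidQuartic (toReal x)) / (16 * π ^ 4) + ∑ x ∈ annulus 4 0 M, err x := by
    rw [herr, Finset.sum_sub_distrib, Finset.sum_div]
    ring
  have herr_pt : ∀ r : ℕ, ∀ x ∈ annulus 4 r (r + 1),
      |err x| ≤ K₃ / ((r : ℝ) + 1) ^ 6 + 2 * K₁ * τ / ((r : ℝ) + 1) ^ 2 + τ ^ 2 := by
    intro r x hx
    have hx0 : x ≠ 0 := ne_zero_of_mem_annulus hx
    have hsup : ((supNorm x : ℕ) : ℝ) = (r : ℝ) + 1 := by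
      rw [supNorm_eq_of_mem_sphere hx]; push_cast; ring
    have hS : ((r : ℝ) + 1) ^ 2 ≤ normSq (toReal x) := by rw [← hsup]; exact sq_supNorm_le_normSq x
    have hρ : (1 : ℝ) ≤ (r : ℝ) + 1 := by have := (Nat.cast_nonneg r : (0 : ℝ) ≤ r); linarith
    show |covSum 4 L 0 k x ^ 2 - euclidQuartic (toReal x) / (16 * π ^ 4)| ≤ _
    rw [hw x]
    exact abs_sq_sub_leading_le hS hρ (hG1 x hx0) (htail x) hK₁ hK₃ (hG2 x hx0)
  have herr_sum : |∑ x ∈ annulus 4 0 M, err x| ≤ Aerr := by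
    refine (abs_sum_annulus_zero_le herr_pt).trans ?_
    calc ∑ r ∈ Finset.range M, ((annulus 4 r (r + 1)).card : ℝ) *
            (K₃ / ((r : ℝ) + 1) ^ 6 + 2 * K₁ * τ / ((r : ℝ) + 1) ^ 2 + τ ^ 2)
        ≤ ∑ r ∈ Finset.range M, 80 * ((r : ℝ) + 1) ^ 3 *
            (K₃ / ((r : ℝ) + 1) ^ 6 + 2 * K₁ * τ / ((r : ℝ) + 1) ^ 2 + τ ^ 2) :=
          Finset.sum_le_sum fun r _ => mul_le_mul_of_nonneg_right (card_annulus_succ_four_le r) (by positivity)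
      _ = 80 * (K₃ * ∑ r ∈ Finset.range M, 1 / ((r : ℝ) + 1) ^ 3 +
            2 * K₁ * τ * ∑ r ∈ Finset.range M, ((r : ℝ) + 1) +
            τ ^ 2 * ∑ r ∈ Finset.range M, ((r : ℝ) + 1) ^ 3) := by
          rw [Finset.mul_sum, Finset.mul_sum, Finset.mul_sum, ← Finset.sum_add_distrib, ← Finset.sum_add_distrib,
            Finset.mul_sum]
          refine Finset.sum_congr rfl fun r _ => ?_
          have hr : (0 : ℝ) < (r : ℝ) + 1 := by positivity
          field_simp
      _ ≤ 80 * (K₃ * 2 + 2 * K₁ * τ * (M : ℝ) ^ 2 + τ ^ 2 * (M : ℝ) ^ 4) := by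
          gcongr
          · exact sum_inv_pow_le_two (by norm_num) M
          · exact sum_range_succ_le_sq M
          · exact sum_range_succ_cube_le M
      _ ≤ Aerr := by
          rw [hAerr]
          have e1 : 2 * K₁ * τ * (M : ℝ) ^ 2 = 2 * K₁ * (τ * (M : ℝ) ^ 2) := by ring
          rw [e1]
          nlinarith [mul_le_mul_of_nonneg_left hτM (by positivity : (0 : ℝ) ≤ 2 * K₁)]
  -- Step 4: the window logarithm
  have hwin := abs_windowSum_euclidQuartic_sub_le hM1
  have hlogM := abs_log_boxRadius_sub_le hL hk
  -- Step 5: assemble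
  rw [hsplit]
  have hπ : (0 : ℝ) < π ^ 2 := by positivity
  have key : 8 * (covSum 4 L 0 k 0 ^ 2 +
        ((∑ x ∈ annulus 4 0 M, euclidQuartic (toReal x)) / (16 * π ^ 4) + ∑ x ∈ annulus 4 0 M, err x)) -
        k * Real.log L / π ^ 2 =
      8 * covSum 4 L 0 k 0 ^ 2 + 8 * ∑ x ∈ annulus 4 0 M, err x +
        ((∑ x ∈ annulus 4 0 M, euclidQuartic (toReal x)) - 2 * π ^ 2 * Real.log M) / (2 * π ^ 4) +
        (Real.log M - k * Real.log L) / π ^ 2 := by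
    field_simp
    ring
  rw [key]
  have b1 : |8 * covSum 4 L 0 k 0 ^ 2| ≤ 8 * (|green 0| + τ₀) ^ 2 := by
    rw [abs_of_nonneg (by positivity)]; linarith
  have b2 : |8 * ∑ x ∈ annulus 4 0 M, err x| ≤ 8 * Aerr := by
    rw [abs_mul, abs_of_pos (by norm_num : (0:ℝ) < 8)]; linarith
  have b3 : |((∑ x ∈ annulus 4 0 M, euclidQuartic (toReal x)) - 2 * π ^ 2 * Real.log M) / (2 * π ^ 4)| ≤
      windowConst / (2 * π ^ 4) := by
    rw [abs_div, abs_of_pos (by positivity : (0:ℝ) < 2 * π ^ 4)]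
    exact div_le_div_of_nonneg_right hwin (by positivity)
  have b4 : |(Real.log M - k * Real.log L) / π ^ 2| ≤ Real.log 2 / π ^ 2 := by
    rw [abs_div, abs_of_pos hπ]
    exact div_le_div_of_nonneg_right hlogM hπ.le
  rw [hA]
  have t1 := abs_add_le (8 * covSum 4 L 0 k 0 ^ 2 + 8 * ∑ x ∈ annulus 4 0 M, err x +
      ((∑ x ∈ annulus 4 0 M, euclidQuartic (toReal x)) - 2 * π ^ 2 * Real.log M) / (2 * π ^ 4))
    ((Real.log M - k * Real.log L) / π ^ 2)
  have t2 := abs_add_le (8 * covSum 4 L 0 k 0 ^ 2 + 8 * ∑ x ∈ annulus 4 0 M, err x)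
    (((∑ x ∈ annulus 4 0 M, euclidQuartic (toReal x)) - 2 * π ^ 2 * Real.log M) / (2 * π ^ 4))
  have t3 := abs_add_le (8 * covSum 4 L 0 k 0 ^ 2) (8 * ∑ x ∈ annulus 4 0 M, err x)
  linarith

/-- **`|Σ_{j<k} β_j(0) − k·(log L)/π²| ≤ A`** for ALL `k ≥ 0` and ALL `L ≥ 2` (Lemma 8.3.1's telescoping
`Σ_{j<k}β_j = 8Σ_xw_k(x)²` + the main estimate; `k = 0` is trivial). The partial sums of the one-loop coefficients grow
LINEARLY in the number of scales with slope `(log L)/π²`, with an `L`-UNIFORM defect.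
[cite: BauerschmidtBrydgesSlade2015LogCorr, Lemma 8.3.1 (proof, first display Σ_{j=0}^{k−1}β_j = 8Σ_xw_k(x)²)] -/
theorem abs_sum_range_betaPT_zero_sub_le : ∃ A : ℝ, 0 ≤ A ∧ ∀ L : ℝ, 2 ≤ L → ∀ k : ℕ,
    |∑ j ∈ Finset.range k, betaPT 4 L 0 j - k * Real.log L / π ^ 2| ≤ A := by
  obtain ⟨A, hA, h⟩ := abs_eight_tsum_covSum_sq_sub_le
  refine ⟨A, hA, fun L hL k => ?_⟩
  rcases Nat.eq_zero_or_pos k with hk | hk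
  · subst hk; simpa using hA
  · rw [sum_range_betaPT_eq_tsum (by norm_num) (by linarith) le_rfl k]
    exact h L hL k hk

/-! ## 6. Consequences: the two-sided bound for every `β_j`, the VALUE of the limit, Lemma 6.3 (a) as printed, and
the (AF-0-L) shape of the audit cell `pub-balaban` inhabited by the BBS coefficients -/

/-- **`|β_j(0) − (log L)/π²| ≤ A` for EVERY `j ≥ 0` and EVERY `L ≥ 2`** (difference of two consecutive partial sums;
`A` independent of `j` and `L`).  In the language of the source: at the critical point the one-loop coefficient of
EVERY scale equals the universal `(log L)/π²` up to an error bounded uniformly in the scale AND in the scale ratio `L`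
— in particular `sup_j|β_j(0)| ≤ (log L)/π² + A` (the first clause of Assumption (A1) at `m² = 0`, with its
`L`-dependence) and `β_j(0) ≥ (log L)/π² − A` (positivity at ALL scales once `log L > π²A`).
[cite: BauerschmidtBrydgesSlade2015RGIII, Lemma 6.3 (a) (d = 4)] -/
theorem abs_betaPT_zero_sub_log_le : ∃ A : ℝ, 0 ≤ A ∧ ∀ L : ℝ, 2 ≤ L → ∀ j : ℕ,
    |betaPT 4 L 0 j - Real.log L / π ^ 2| ≤ A := by
  obtain ⟨A, hA, h⟩ := abs_sum_range_betaPT_zero_sub_le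
  refine ⟨2 * A, by positivity, fun L hL j => ?_⟩
  have h1 := h L hL (j + 1)
  have h2 := h L hL j
  rw [Finset.sum_range_succ] at h1
  have e : betaPT 4 L 0 j - Real.log L / π ^ 2 =
      (∑ i ∈ Finset.range j, betaPT 4 L 0 i + betaPT 4 L 0 j - ((j + 1 : ℕ) : ℝ) * Real.log L / π ^ 2) -
        (∑ i ∈ Finset.range j, betaPT 4 L 0 i - (j : ℝ) * Real.log L / π ^ 2) := by
    push_cast
    ring
  rw [e]
  have := abs_sub (∑ i ∈ Finset.range j, betaPT 4 L 0 i + betaPT 4 L 0 j - ((j + 1 : ℕ) : ℝ) * Real.log L / π ^ 2)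
    (∑ i ∈ Finset.range j, betaPT 4 L 0 i - (j : ℝ) * Real.log L / π ^ 2)
  linarith

/-- The Cesàro means of the `β_j(0)` converge to `(log L)/π²` (from the `L`-uniform partial-sum estimate). [folklore] -/
theorem tendsto_cesaro_betaPT_zero {L : ℝ} (hL : 2 ≤ L) :
    Tendsto (fun n : ℕ => (n⁻¹ : ℝ) * ∑ j ∈ Finset.range n, betaPT 4 L 0 j) atTop
      (𝓝 (Real.log L / π ^ 2)) := by
  obtain ⟨A, hA, h⟩ := abs_sum_range_betaPT_zero_sub_le
  rw [← tendsto_sub_nhds_zero_iff]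
  have hlim : Tendsto (fun n : ℕ => A / (n : ℝ)) atTop (𝓝 0) := tendsto_const_div_atTop_nhds_zero_nat A
  refine squeeze_zero_norm' ?_ hlim
  filter_upwards [Filter.eventually_ge_atTop 1] with n hn
  have hn0 : (0 : ℝ) < n := by exact_mod_cast hn
  have e : (n⁻¹ : ℝ) * ∑ j ∈ Finset.range n, betaPT 4 L 0 j - Real.log L / π ^ 2 =
      (∑ j ∈ Finset.range n, betaPT 4 L 0 j - n * Real.log L / π ^ 2) / n := by
    field_simp
  rw [e, Real.norm_eq_abs, abs_div, abs_of_pos hn0]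
  exact div_le_div_of_nonneg_right (h L hL n) hn0.le

/-- **THE VALUE OF THE LIMIT: `b̄_L = (log L)/π²`** for the tree's `CTWSAW.betaLim L = 8[J₀ + 2Σ_{l≥1}L^{−2l}J_l]`
(`L ≥ 2`) — Cesàro means of a convergent sequence converge to its limit, and the Cesàro means converge to `(log L)/π²`.
This identifies the scaling-function series of `WeaklySAWPerturbativeBetaLimit` with the universal number of the
source. [cite: BauerschmidtBrydgesSlade2015RGIII, Lemma 6.3 (a) (d = 4: «lim_{j→∞} β_j = (log L)/π²»)] -/
theorem betaLim_eq_log {L : ℝ} (hL : 2 ≤ L) : betaLim L = Real.log L / π ^ 2 :=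
  tendsto_nhds_unique (tendsto_betaPT_zero hL).cesaro (tendsto_cesaro_betaPT_zero hL)

/-- **BBS-III, LEMMA 6.3 (a), `d = 4`, AS PRINTED: `lim_{j→∞} β_j = (log L)/π²` at `m² = 0`** — for the explicit
finite-range decomposition of the tree and every real `L ≥ 2`.
[cite: BauerschmidtBrydgesSlade2015RGIII, Lemma 6.3 (a)] -/
theorem BBS2015RGIII_lem63a {L : ℝ} (hL : 2 ≤ L) :
    Tendsto (fun j : ℕ => betaPT 4 L 0 j) atTop (𝓝 (Real.log L / π ^ 2)) := by
  rw [← betaLim_eq_log hL]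
  exact tendsto_betaPT_zero hL

/-- The scaling-function series evaluated: `8·(2Σ_{l≥0}L^{−2l}J_l − J_0) = (log L)/π²`, `J_l = ∫G_L(y,0)G_L(y/L^l,0)dy`
(the tree's `FRD.innerG0`) — the analogue, for the lattice construction of the tree, of the printed
`β_∞ = 8Σ_{k∈ℤ}⟨c₀,c_k⟩ = (log L)/π²`. [cite: BauerschmidtBrydgesSlade2015RGIII, Lemma 6.3 (proof of (a), display β_∞ = 8Σ_{k=−∞}^{∞}⟨c₀,c_k⟩)] -/
theorem innerG0_series_eq_log {L : ℝ} (hL : 2 ≤ L) :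
    8 * (2 * ∑' l : ℕ, (1 / L ^ 2) ^ l * innerG0 4 L l - innerG0 4 L 0) = Real.log L / π ^ 2 := by
  rw [← betaLim_eq_log hL, betaLim]

section CellShape

open Literature.MathematicalPhysics.QuantumFieldTheory.Balaban1983to89.Beta.LargeL (LogGrowth LogGrowthLower
  uniform_lower_of_exp_le)

/-- **THE (AF-0-L) SHAPE OF THE AUDIT CELL, INHABITED BY THE BBS COEFFICIENTS.**  In the β sub-cell of the audit of
T. Bałaban's lattice Yang–Mills series (`pub-balaban`) the located flow input is typed as
`Beta.LargeL.LogGrowth β0 b A : ∀ L ≥ 2, ∀ k, |β0 L k − b·log L| ≤ A` (universal logarithm + remainder bounded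
uniformly in the scale AND in `L`; a HYPOTHESIS SHAPE there, asserted of nothing).  For the actual one-loop
coefficients of the Bauerschmidt–Brydges–Slade finite-range scheme of the 4d weakly self-avoiding walk that shape is a
THEOREM, with `b = 1/π²`: `LogGrowth (fun L k => β_k(0)) (1/π²) A`.  (A statement about a SIBLING model; nothing about
Bałaban's (1.22) follows.) [cite: BauerschmidtBrydgesSlade2015RGIII, Lemma 6.3 (a)] -/
theorem logGrowth_betaPT_zero : ∃ A : ℝ, 0 ≤ A ∧ LogGrowth (fun L k => betaPT 4 (L : ℝ) 0 k) (1 / π ^ 2) A := by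
  obtain ⟨A, hA, h⟩ := abs_betaPT_zero_sub_log_le
  refine ⟨A, hA, fun L hL k => ?_⟩
  have hL' : (2 : ℝ) ≤ (L : ℝ) := by exact_mod_cast hL
  have := h (L : ℝ) hL' k
  rwa [one_div_mul_eq_div]

/-- The one-sided form `LogGrowthLower (fun L k => β_k(0)) (1/π²) A`. [folklore] -/
theorem logGrowthLower_betaPT_zero : ∃ A : ℝ, 0 ≤ A ∧ LogGrowthLower (fun L k => betaPT 4 (L : ℝ) 0 k) (1 / π ^ 2) A := by
  obtain ⟨A, hA, h⟩ := logGrowth_betaPT_zero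
  exact ⟨A, hA, h.lower⟩

/-- **(AF-0) AT ALL SCALES FOR LARGE `L`, by the cell's own bookkeeping** (`Beta.LargeL.uniform_lower_of_exp_le`): for
every target `b₀` and every natural `L ≥ 2` with `exp(π²(A + 2b₀)) ≤ L`, `β_k(0) ≥ 2b₀` for EVERY `k ≥ 0` — no
exceptional scales.  (The source fixes `L` and proves `β_j(m²) ≥ c` for `n ≤ j ≤ j_m − n`, Lemma 6.3.1; the
`L`-large form is the Gawędzki–Kupiainen mechanism, cf. `GawedzkiKupiainen1985.LLargeDominance`.) [folklore] -/
theorem le_betaPT_zero_of_exp_le : ∃ A : ℝ, 0 ≤ A ∧ ∀ b₀ : ℝ, ∀ L : ℕ, 2 ≤ L →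
    Real.exp (π ^ 2 * (A + 2 * b₀)) ≤ L → ∀ k : ℕ, 2 * b₀ ≤ betaPT 4 (L : ℝ) 0 k := by
  obtain ⟨A, hA, h⟩ := logGrowthLower_betaPT_zero
  refine ⟨A, hA, fun b₀ L hL hexp k => ?_⟩
  have hπ : (0 : ℝ) < 1 / π ^ 2 := by positivity
  have e : (A + 2 * b₀) / (1 / π ^ 2) = π ^ 2 * (A + 2 * b₀) := by field_simp
  exact uniform_lower_of_exp_le h hπ b₀ hL (by rwa [e]) k

end CellShape

/-- The same for REAL `L ≥ 2` (the tree's decomposition has a real scale ratio): if `π²(A + m) ≤ log L` then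
`β_j(0) ≥ m` for every `j`; in particular `β_j(0) > 0` for ALL `j` as soon as `log L > π²A`. [folklore] -/
theorem le_betaPT_zero_of_le_log : ∃ A : ℝ, 0 ≤ A ∧ ∀ L : ℝ, 2 ≤ L → ∀ m : ℝ,
    π ^ 2 * (A + m) ≤ Real.log L → ∀ j : ℕ, m ≤ betaPT 4 L 0 j := by
  obtain ⟨A, hA, h⟩ := abs_betaPT_zero_sub_log_le
  refine ⟨A, hA, fun L hL m hm j => ?_⟩
  have h1 := (abs_le.mp (h L hL j)).1
  have hπ : (0 : ℝ) < π ^ 2 := by positivity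
  have h2 : A + m ≤ Real.log L / π ^ 2 := by
    rw [le_div_iff₀ hπ]; linarith
  linarith

/-! ## 7. (AF-0r): the printed RATE `β_j(0) = β_∞ + O(L^{−j})` (BBS-III (6.78)) for the explicit decomposition,
and the audit cell's `LimitForm.conv` shape `|β⁰_{k+1} − β⁰_∞| ≤ c₀θ^k` INHABITED with `θ = 1/L`

Source, verbatim (arXiv TeX of [BauerschmidtBrydgesSlade2015RGIII], proof of Lemma 6.3 (a), display `(betajinf)` =
(6.78)): «β_j = 8(w_{j+1}^{(2)} − w_j^{(2)}) = β_∞ + O(L^{−j}) with β_∞ = 8Σ_{k=−∞}^{∞}⟨c₀,c_k⟩».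
`WeaklySAWPerturbativeBetaLimit.abs_betaPT_zero_sub_betaApprox_le` proves `|β_j(0) − b̄_j| ≤ K(j+1)L^{−j}`; the
factor `(j+1)` there comes from bounding each of the `j−1` middle pair-sum errors `C·L^{−2(j−i)}·L^{−(i+1)} =
C·L^{−(j+1)}·L^{−(j−i)}` (`abs_pairSum_mid_sub_le`) by `C·L^{−(j+1)}`.  Keeping the factor `L^{−(j−i)}` and summing
the geometric series removes it (`abs_betaPT_zero_sub_betaApprox_le_geom`) — this is the printed `O(L^{−j})`; the
tail `b̄_L − b̄_j = 16Σ_{l≥j}L^{−2l}J_l = O(L^{−2j})` (`abs_betaLim_sub_betaApprox_le`) is smaller.  Consequences: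
`abs_betaPT_zero_sub_log_le_rate` — `|β_j(0) − (log L)/π²| ≤ c₀L^{−j}` for EVERY `j ≥ 0` (the printed (6.78) with
the printed `β_∞`, for the tree's decomposition; `c₀ = c₀(L)`), and `limitForm_conv_shape_betaPT_zero` — the audit
cell's (AF-0r) hypothesis shape (`Beta.Assembly.LimitForm`: fields `binf_pos`, `c₀_nonneg`, `θ_nonneg`,
`θ_lt_one`, `conv : ∀ k, |β⁰ k − binf| ≤ c₀θ^k`; a HYPOTHESIS there, asserted of nothing) holds for the BBS
coefficients with `binf = (log L)/π²` and the blocking rate `θ = 1/L` itself (no polynomial prefactor).  SIBLING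
model; nothing about Bałaban's (1.22) follows (for Bałaban (AF-0r) is the T⁴ cell's road-(2) input, BETA-SPEC
§7.23 (d)); audit cell `pub-balaban`, row BETA-lit2, unit `b2b-balaban-beta-lit2` gen 9, prose
`run/shared/lean/pub/pub-balaban/BETA/TRANSFER.md` §25. -/

/-- **`|β_j(0) − b̄_j| ≤ K·L^{−j}`** for `j ≥ 1`, `L ≥ 2` — the sharp form of
`abs_betaPT_zero_sub_betaApprox_le` (no factor `(j+1)`): the middle pair-sum errors are
`C·L^{−(j+1)}·L^{−(j−i)}` and `Σ_{1≤i<j}L^{−(j−i)} ≤ (1/L)/(1 − 1/L) ≤ 1`.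
[cite: BauerschmidtBrydgesSlade2015RGIII, Lemma 6.3 (proof of (a), display (6.78) «β_j = β_∞ + O(L^{−j})»)] -/
theorem abs_betaPT_zero_sub_betaApprox_le_geom {L : ℝ} (hL : 2 ≤ L) :
    ∃ K : ℝ, 0 < K ∧ ∀ j : ℕ, 1 ≤ j →
      |betaPT 4 L 0 j - betaApprox L j| ≤ K * (1 / L) ^ j := by
  have hL0 : (0 : ℝ) < L := by linarith
  have hL1 : (1 : ℝ) ≤ L := by linarith
  obtain ⟨C, hC, hA⟩ := sum_Gam_mul_Gam_asymp (d := 4) (by norm_num) hL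
  obtain ⟨c, hc, hG⟩ := abs_Gam_four_le
  refine ⟨8 * (3 * C + 32 * c ^ 2 * L ^ 4), by positivity, fun j hj => ?_⟩
  set r : ℝ := 1 / L with hr
  have hr0 : 0 < r := by rw [hr]; positivity
  have hr2' : r ≤ 1 / 2 := by rw [hr]; exact one_div_le_one_div_of_le two_pos hL
  have hr1 : r ≤ 1 := hr2'.trans (by norm_num)
  have hrL : ∀ n : ℕ, (L ^ n)⁻¹ = r ^ n := fun n => by rw [hr, one_div, inv_pow]
  have hr2 : ∀ n : ℕ, (1 / L ^ 2) ^ n = r ^ n * r ^ n := fun n => by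
    rw [hr, one_div, one_div, inv_pow, inv_pow, ← mul_inv, ← pow_mul, ← pow_add]
    ring_nf
  -- the pair-sum decomposition
  set S : ℕ → ℝ := fun i => ∑ x ∈ PT.ball (L ^ (j + 1) / 2), Gam 4 L 0 (i + 1) x * Gam 4 L 0 (j + 1) x
    with hS
  have hβ : betaPT 4 L 0 j = 8 * (S j + 2 * ∑ i ∈ Finset.range j, S i) := betaPT_zero_eq_pairSums hL1 j
  have hsplit : ∑ i ∈ Finset.range j, S i = S 0 + ∑ i ∈ Finset.Ico 1 j, S i := by
    rw [Finset.range_eq_Ico, Finset.sum_eq_sum_Ico_succ_bot hj]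
  -- the three estimates
  have htop : |S j - innerG0 4 L 0| ≤ C * r ^ (j + 1) := by
    rw [← hrL]; exact abs_pairSum_top_sub_le hL hA hj
  have hone : |S 0| ≤ 16 * c ^ 2 * L ^ 4 * (r ^ j * r ^ j) := by
    have := abs_pairSum_one_le hL hc.le hG j
    rw [hS]
    refine this.trans (le_of_eq ?_)
    rw [← hr2, one_div, inv_pow, ← pow_mul, div_eq_mul_inv]
  -- middle terms WITH the geometric factor `r^{j-i}` kept
  have hmid : ∀ i ∈ Finset.Ico 1 j,
      |S i - (1 / L ^ 2) ^ (j - i) * innerG0 4 L (j - i)| ≤ C * r ^ (j + 1) * r ^ (j - i) := by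
    intro i hi
    rw [Finset.mem_Ico] at hi
    have h := abs_pairSum_mid_sub_le hL hA hi.1 hi.2
    refine h.trans (le_of_eq ?_)
    rw [hrL, hr2]
    have h2 : r ^ (j - i) * r ^ (i + 1) = r ^ (j + 1) := by
      rw [← pow_add]; congr 1; omega
    calc C * (r ^ (j - i) * r ^ (j - i)) * r ^ (i + 1)
        = C * (r ^ (j - i) * r ^ (i + 1)) * r ^ (j - i) := by ring
      _ = C * r ^ (j + 1) * r ^ (j - i) := by rw [h2]
  -- the geometric sum `Σ_{1≤i<j} r^{j-i} = Σ_{1≤m<j} r^m ≤ r/(1-r) ≤ 1`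
  have hgeom : ∑ i ∈ Finset.Ico 1 j, r ^ (j - i) ≤ 1 := by
    have hrefl := Finset.sum_Ico_reflect (fun m => r ^ m) 1 (m := j) (n := j) (Nat.le_succ j)
    rw [show j + 1 - j = 1 by omega, show j + 1 - 1 = j by omega] at hrefl
    rw [hrefl]
    have hlt : r < 1 := by linarith
    calc ∑ m ∈ Finset.Ico 1 j, r ^ m ≤ r ^ 1 / (1 - r) := geom_sum_Ico_le_of_lt_one hr0.le hlt
      _ ≤ 1 := by rw [pow_one, div_le_one (by linarith)]; linarith
  have hsum : |∑ i ∈ Finset.Ico 1 j, (S i - (1 / L ^ 2) ^ (j - i) * innerG0 4 L (j - i))| ≤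
      C * r ^ (j + 1) := by
    refine (Finset.abs_sum_le_sum_abs _ _).trans ((Finset.sum_le_sum hmid).trans ?_)
    rw [← Finset.mul_sum]
    have hCr : 0 ≤ C * r ^ (j + 1) := by positivity
    calc C * r ^ (j + 1) * ∑ i ∈ Finset.Ico 1 j, r ^ (j - i) ≤ C * r ^ (j + 1) * 1 :=
          mul_le_mul_of_nonneg_left hgeom hCr
      _ = C * r ^ (j + 1) := mul_one _
  -- assemble
  have hdiff : betaPT 4 L 0 j - betaApprox L j =
      8 * ((S j - innerG0 4 L 0) + 2 * S 0 +
        2 * ∑ i ∈ Finset.Ico 1 j, (S i - (1 / L ^ 2) ^ (j - i) * innerG0 4 L (j - i))) := by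
    rw [hβ, hsplit]
    unfold betaApprox
    have hrefl : ∑ l ∈ Finset.Ico 1 j, (1 / L ^ 2) ^ l * innerG0 4 L l =
        ∑ i ∈ Finset.Ico 1 j, (1 / L ^ 2) ^ (j - i) * innerG0 4 L (j - i) := by
      have := Finset.sum_Ico_reflect (fun l => (1 / L ^ 2) ^ l * innerG0 4 L l) 1 (m := j) (n := j)
        (Nat.le_succ j)
      rw [show j + 1 - j = 1 by omega, show j + 1 - 1 = j by omega] at this
      exact this.symm
    rw [hrefl, Finset.sum_sub_distrib]
    ring
  rw [hdiff, abs_mul, show |(8 : ℝ)| = 8 by norm_num]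
  have hrj : r ^ (j + 1) ≤ r ^ j := pow_le_pow_of_le_one hr0.le hr1 (Nat.le_succ j)
  have hrjj : r ^ j * r ^ j ≤ r ^ j := mul_le_of_le_one_right (by positivity) (pow_le_one₀ hr0.le hr1)
  calc 8 * |(S j - innerG0 4 L 0) + 2 * S 0 +
        2 * ∑ i ∈ Finset.Ico 1 j, (S i - (1 / L ^ 2) ^ (j - i) * innerG0 4 L (j - i))|
      ≤ 8 * (|S j - innerG0 4 L 0| + 2 * |S 0| +
        2 * |∑ i ∈ Finset.Ico 1 j, (S i - (1 / L ^ 2) ^ (j - i) * innerG0 4 L (j - i))|) := by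
        refine mul_le_mul_of_nonneg_left ?_ (by norm_num)
        refine (abs_add_le _ _).trans (add_le_add ((abs_add_le _ _).trans (add_le_add le_rfl ?_)) ?_)
        · rw [abs_mul, abs_two]
        · rw [abs_mul, abs_two]
    _ ≤ 8 * (C * r ^ (j + 1) + 2 * (16 * c ^ 2 * L ^ 4 * (r ^ j * r ^ j)) + 2 * (C * r ^ (j + 1))) := by
        gcongr
    _ ≤ 8 * (C * r ^ j + 2 * (16 * c ^ 2 * L ^ 4 * r ^ j) + 2 * (C * r ^ j)) := by
        have h1 : 16 * c ^ 2 * L ^ 4 * (r ^ j * r ^ j) ≤ 16 * c ^ 2 * L ^ 4 * r ^ j :=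
          mul_le_mul_of_nonneg_left hrjj (by positivity)
        have h2 : C * r ^ (j + 1) ≤ C * r ^ j := mul_le_mul_of_nonneg_left hrj hC.le
        linarith
    _ = 8 * (3 * C + 32 * c ^ 2 * L ^ 4) * r ^ j := by ring

/-- **The tail of the scaling-function series: `|b̄_L − b̄_j| ≤ K'·L^{−2j}`** for `j ≥ 1`, `L ≥ 2`
(`b̄_L − b̄_j = 16Σ_{l≥j}L^{−2l}J_l`, `|J_l| ≤ K`, `L^{−2} ≤ ¼`; `K' = 16K·4/3`).
[cite: BauerschmidtBrydgesSlade2015RGIII, Lemma 6.3 (proof of (a): «Σ_{k=j+1}^{∞}|⟨c₀,c_k⟩| ≤ … ≤ O(L^{−2j})»)] -/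
theorem abs_betaLim_sub_betaApprox_le {L : ℝ} (hL : 2 ≤ L) :
    ∃ K' : ℝ, 0 ≤ K' ∧ ∀ j : ℕ, 1 ≤ j → |betaLim L - betaApprox L j| ≤ K' * (1 / L ^ 2) ^ j := by
  obtain ⟨K, hK, hb⟩ := abs_innerG0_le (d := 4) (by norm_num) hL
  have hq0 : (0 : ℝ) ≤ 1 / L ^ 2 := by positivity
  have hq1 : 1 / L ^ 2 ≤ 1 / 4 := one_div_le_one_div_of_le (by norm_num) (by nlinarith)
  have hq1' : 1 / L ^ 2 < 1 := by linarith
  have hsum := summable_innerG0_geometric hL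
  refine ⟨16 * K * (4 / 3), by positivity, fun j hj => ?_⟩
  -- `b̄_L − b̄_j = 16·Σ_{l≥0} q^{l+j} J_{l+j}`
  have hdiff : betaLim L - betaApprox L j =
      16 * ∑' l : ℕ, (1 / L ^ 2) ^ (l + j) * innerG0 4 L (l + j) := by
    have h1 := hsum.sum_add_tsum_nat_add j
    have h2 : ∑ l ∈ Finset.range j, (1 / L ^ 2) ^ l * innerG0 4 L l =
        innerG0 4 L 0 + ∑ l ∈ Finset.Ico 1 j, (1 / L ^ 2) ^ l * innerG0 4 L l := by
      rw [Finset.range_eq_Ico, Finset.sum_eq_sum_Ico_succ_bot hj, pow_zero, one_mul]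
    unfold betaLim betaApprox
    rw [← h1, h2]
    ring
  rw [hdiff, abs_mul, show |(16 : ℝ)| = 16 by norm_num]
  -- `|Σ' q^{l+j} J_{l+j}| ≤ Σ' q^{l+j} K = q^j K (1−q)⁻¹ ≤ q^j K · 4/3`
  have hgeo : HasSum (fun l : ℕ => (1 / L ^ 2) ^ (l + j) * K)
      ((1 / L ^ 2) ^ j * K * (1 - 1 / L ^ 2)⁻¹) := by
    have h := (hasSum_geometric_of_lt_one hq0 hq1').mul_left ((1 / L ^ 2) ^ j * K)
    have e : (fun l : ℕ => (1 / L ^ 2) ^ j * K * (1 / L ^ 2) ^ l) =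
        fun l => (1 / L ^ 2) ^ (l + j) * K := by
      funext l; rw [pow_add]; ring
    rwa [e] at h
  have hle : |∑' l : ℕ, (1 / L ^ 2) ^ (l + j) * innerG0 4 L (l + j)| ≤
      (1 / L ^ 2) ^ j * K * (1 - 1 / L ^ 2)⁻¹ := by
    refine (Real.norm_eq_abs _).symm.le.trans (tsum_of_norm_bounded hgeo fun l => ?_)
    rw [Real.norm_eq_abs, abs_mul, abs_of_nonneg (pow_nonneg hq0 _)]
    exact mul_le_mul_of_nonneg_left (hb (l + j)) (pow_nonneg hq0 _)
  have hinv : (1 - 1 / L ^ 2)⁻¹ ≤ 4 / 3 := by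
    rw [inv_le_comm₀ (by linarith) (by norm_num)]
    linarith
  calc 16 * |∑' l : ℕ, (1 / L ^ 2) ^ (l + j) * innerG0 4 L (l + j)|
      ≤ 16 * ((1 / L ^ 2) ^ j * K * (1 - 1 / L ^ 2)⁻¹) := by gcongr
    _ ≤ 16 * ((1 / L ^ 2) ^ j * K * (4 / 3)) := by
        gcongr
    _ = 16 * K * (4 / 3) * (1 / L ^ 2) ^ j := by ring

/-- **BBS-III (6.78) FOR THE TREE'S DECOMPOSITION, WITH THE PRINTED LIMIT: `|β_j(0) − (log L)/π²| ≤ c₀·L^{−j}` for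
EVERY `j ≥ 0` and every real `L ≥ 2`** (`c₀ = c₀(L) ≥ 0`; `j = 0` is covered by the `L`-uniform bound
`abs_betaPT_zero_sub_log_le`).  The rate is the blocking ratio `1/L` itself — one scaling-limit error
`C_{j} = c_j + O(L^{−3j})` against the size `L^{−2j}` of the slice (Prop. 6.1 (c)), as in print.
[cite: BauerschmidtBrydgesSlade2015RGIII, Lemma 6.3 (proof of (a), display (6.78) «β_j = β_∞ + O(L^{−j}) with β_∞ = 8Σ_{k=−∞}^{∞}⟨c₀,c_k⟩»; Lemma 6.3 (a) «lim_{j→∞} β_j = (log L)/π² for d = 4»)] -/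
theorem abs_betaPT_zero_sub_log_le_rate {L : ℝ} (hL : 2 ≤ L) :
    ∃ c₀ : ℝ, 0 ≤ c₀ ∧ ∀ j : ℕ, |betaPT 4 L 0 j - Real.log L / π ^ 2| ≤ c₀ * (1 / L) ^ j := by
  have hL0 : (0 : ℝ) < L := by linarith
  obtain ⟨K, hK, h1⟩ := abs_betaPT_zero_sub_betaApprox_le_geom hL
  obtain ⟨K', hK', h2⟩ := abs_betaLim_sub_betaApprox_le hL
  obtain ⟨A, hA, h0⟩ := abs_betaPT_zero_sub_log_le
  refine ⟨K + K' + A, by positivity, fun j => ?_⟩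
  have hr0 : (0 : ℝ) ≤ 1 / L := by positivity
  rcases Nat.eq_zero_or_pos j with hj | hj
  · subst hj
    rw [pow_zero, mul_one]
    have := h0 L hL 0
    linarith
  · rw [← betaLim_eq_log hL]
    have e : betaPT 4 L 0 j - betaLim L =
        (betaPT 4 L 0 j - betaApprox L j) - (betaLim L - betaApprox L j) := by ring
    rw [e]
    have hq : (1 / L ^ 2) ^ j ≤ (1 / L) ^ j := by
      refine pow_le_pow_left₀ (by positivity) ?_ j
      exact one_div_le_one_div_of_le hL0 (by nlinarith)
    have hrj : 0 ≤ (1 / L) ^ j := pow_nonneg hr0 j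
    calc |(betaPT 4 L 0 j - betaApprox L j) - (betaLim L - betaApprox L j)|
        ≤ |betaPT 4 L 0 j - betaApprox L j| + |betaLim L - betaApprox L j| := abs_sub _ _
      _ ≤ K * (1 / L) ^ j + K' * (1 / L ^ 2) ^ j := add_le_add (h1 j hj) (h2 j hj)
      _ ≤ K * (1 / L) ^ j + K' * (1 / L) ^ j := by gcongr
      _ ≤ (K + K' + A) * (1 / L) ^ j := by nlinarith

/-- **THE AUDIT CELL'S (AF-0r) SHAPE, INHABITED BY THE BBS COEFFICIENTS WITH `θ = 1/L`.**  In the β sub-cell of the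
audit of T. Bałaban's lattice Yang–Mills series (`pub-balaban`) the limit-form carrier `Beta.Assembly.LimitForm`
types the located flow input (AF-0∞)+(AF-0r) as DATA `binf > 0`, `c₀ ≥ 0`, `0 ≤ θ < 1` with
`conv : ∀ k, |β⁰ k − binf| ≤ c₀·θ^k` (a HYPOTHESIS SHAPE there — for Bałaban's family it is the T⁴ cell's road-(2)
input, asserted of nothing).  For the actual critical one-loop coefficients `β_k(0)` of the Bauerschmidt–Brydges–Slade
finite-range scheme (4d weakly self-avoiding walk / `|φ|⁴`) that shape is a THEOREM with `binf = (log L)/π²` and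
the blocking rate `θ = 1/L` (no polynomial prefactor), for every real `L ≥ 2`.  A statement about a SIBLING model;
nothing about Bałaban's (1.22) follows. [cite: BauerschmidtBrydgesSlade2015RGIII, Lemma 6.3 (a) and (6.78)] -/
theorem limitForm_conv_shape_betaPT_zero {L : ℝ} (hL : 2 ≤ L) :
    ∃ binf c₀ θ : ℝ, 0 < binf ∧ 0 ≤ c₀ ∧ 0 ≤ θ ∧ θ < 1 ∧
      ∀ k : ℕ, |betaPT 4 L 0 k - binf| ≤ c₀ * θ ^ k := by
  obtain ⟨c₀, hc₀, h⟩ := abs_betaPT_zero_sub_log_le_rate hL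
  refine ⟨Real.log L / π ^ 2, c₀, 1 / L, ?_, hc₀, by positivity, ?_, h⟩
  · have : 0 < Real.log L := Real.log_pos (by linarith)
    positivity
  · rw [div_lt_one (by linarith)]
    linarith

/-- The same data with the limit NAMED as the tree's `betaLim L` (`= (log L)/π²`, `betaLim_eq_log`):
`|β_k(0) − betaLim L| ≤ c₀·(1/L)^k` for all `k`. [cite: BauerschmidtBrydgesSlade2015RGIII, Lemma 6.3 (a) and (6.78)] -/
theorem abs_betaPT_zero_sub_betaLim_le_rate {L : ℝ} (hL : 2 ≤ L) :
    ∃ c₀ : ℝ, 0 ≤ c₀ ∧ ∀ k : ℕ, |betaPT 4 L 0 k - betaLim L| ≤ c₀ * (1 / L) ^ k := by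
  rw [betaLim_eq_log hL]
  exact abs_betaPT_zero_sub_log_le_rate hL

end CTWSAW

end Literature.Barriers.CriticalPhenomena
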